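import Mathlib
import Summits.ResolutionOfSingularities.ResolutionOfSingularities.Theorems.WildQuotientsKiralyLutkebohmertLemmas
import Summits.ResolutionOfSingularities.ResolutionOfSingularities.Theorems.WildQuotientsKiralyLutkebohmertPseudoreflection
import HarnessLib

/-!
# Király–Lütkebohmert (ANT 7 (2013)), Prop. 5 with its explicit basis and Thm. 2 (a) ⇒ (e):
# a principal augmentation ideal makes the action a pseudoreflection

Route `ResolutionOfSingularities/WildQuotients`; helper toward the depth-0 / kill-criterion dictionary
of the crux `CyclicQuotientFourfolds` (stmt-ResolutionOfSingularities-17941, research stub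
`stub_reachLowerInFX`). F. Király, W. Lütkebohmert, *Group actions of prime order on local normal
rings*, Algebra & Number Theory 7 (2013) 63–74, §1.

* `kl_exists_basis_pow` — **Prop. 5 with the basis made explicit**: for a local domain `B`, a ring
  automorphism `σ` with `σ^p = 1` (`p` prime) and an augmentation generator `y`
  (`(σ c − c : c ∈ B) = (σ y − y) ≠ 0`), the powers `1, y, …, y^{p−1}` form a basis of `B` over the
  fixed ring `A = B^σ`: `B = ⊕_{i<p} A·yⁱ`. The proof is the tree's proof of `kl_free`
  (`WildQuotientsKiralyLutkebohmert.lean`, which only exported `Module.Free`) verbatim, with the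
  basis returned instead of forgotten — adapted from that file.
* `kl_exists_fixed_add_mul` — consequence `B = A + y·B`: every element is an invariant plus a
  multiple of `y`.
* `kl_pseudoreflection_of_isPrincipal` — **Thm. 2 (a) ⇒ (e)** (residue-trivial case
  `k_A = k_B`, rendered as `∀ b, ∃ a, σ a = a ∧ b − a ∈ 𝔪_B`; `B` a local Noetherian domain): if the
  augmentation ideal is principal then from ANY finite generating family `x₀, …, xₙ` of `𝔪_B` one
  index `i` may be kept (`σ xᵢ − xᵢ` generates the augmentation ideal, Prop. 6 (ii)) and every
  other generator replaced by a `σ`-INVARIANT element without changing the generated ideal `𝔪_B` —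
  `σ` acts as a pseudoreflection (Def. 1; for `B` regular and `n + 1 = dim B` this is a system of
  parameters `(xᵢ, x̃ⱼ)` with the `x̃ⱼ` invariant, as printed).

With `kl_augIdeal_eq_span_singleton_of_pseudoreflection` (`…Pseudoreflection.lean`, (e) ⇒ (a))
this completes Thm. 2's equivalence (a) ⇔ (e) in the tree.

[OURS · crux stmt-ResolutionOfSingularities-17941 · helper (def-free), printed statements of
KiralyLutkebohmert2013 Prop. 5 / Thm. 2; counted 0; AI-level work, weaker than expert review.]
-/

-- single-problem summit: the doubled namespace component `ResolutionOfSingularities` is forced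
set_option linter.dupNamespace false

open IsLocalRing

namespace Summit.ResolutionOfSingularities.ResolutionOfSingularities.Theorems

section Basis

/-- **Király–Lütkebohmert, Proposition 5 (explicit basis)**: let `B` be a local domain, `σ` a ring
automorphism with `σ^p = 1` (`p` prime) and `y` an augmentation generator
(`(σ c − c : c ∈ B) = (σ y − y) ≠ 0`). Then `1, y, …, y^{p−1}` is a basis of `B` as a module over
the fixed ring `B^σ`: `B = B^σ·y⁰ ⊕ ⋯ ⊕ B^σ·y^{p−1}`. (Proof = the tree's `kl_free`, keeping the
basis.) [cite: KiralyLutkebohmert2013, Prop. 5, pp. 67–68] -/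
theorem kl_exists_basis_pow {B : Type*} [CommRing B] [IsDomain B] [IsLocalRing B] {p : ℕ}
    (hp : p.Prime) (σ : B ≃+* B) (hσ : σ ^ p = 1) (y : B) (hy : σ y - y ≠ 0)
    (hI : Ideal.span (Set.range fun c : B => σ c - c) = Ideal.span {σ y - y}) :
    ∃ b : Module.Basis (Fin p) ((σ : B →+* B).eqLocus (RingHom.id B)) B,
      ∀ i, (b i : B) = y ^ (i : ℕ) := by
  -- adapted from Theorems/WildQuotientsKiralyLutkebohmert.lean (`kl_free`), same argument
  classical
  haveI : Fact p.Prime := ⟨hp⟩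
  set A : Subring B := (σ : B →+* B).eqLocus (RingHom.id B) with hA_def
  have memA : ∀ b : B, b ∈ A ↔ σ b = b := fun b => Iff.rfl
  -- the fraction field and the induced automorphism
  let L := FractionRing B
  let ι : B →+* L := algebraMap B L
  have hι : Function.Injective ι := IsFractionRing.injective B L
  let σL : L ≃+* L := IsFractionRing.ringEquivOfRingEquivHom B L σ
  have hσLpow : ∀ (k : ℕ) (b : B), (σL ^ k) (ι b) = ι ((σ ^ k) b) := by
    intro k b
    have : σL ^ k = IsFractionRing.ringEquivOfRingEquivHom B L (σ ^ k) := (map_pow _ σ k).symm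
    rw [this, IsFractionRing.ringEquivOfRingEquivHom_apply,
      IsFractionRing.ringEquivOfRingEquiv_algebraMap]
  have hσL : ∀ b, σL (ι b) = ι (σ b) := fun b => by simpa using hσLpow 1 b
  have hσLp : σL ^ p = 1 := by
    rw [show σL = IsFractionRing.ringEquivOfRingEquivHom B L σ from rfl, ← map_pow, hσ, map_one]
  have hσL1 : σL ≠ 1 := by
    intro h
    apply hy
    have := hσL y
    rw [h, RingAut.one_apply] at this
    rw [sub_eq_zero]
    exact (hι this).symm
  -- the cyclic group generated by `σL` and its fixed field `K`
  let G : Subgroup (L ≃+* L) := Subgroup.zpowers σL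
  have hfin : IsOfFinOrder σL := isOfFinOrder_iff_pow_eq_one.mpr ⟨p, hp.pos, hσLp⟩
  haveI : Fintype G := Fintype.ofEquiv _ (finEquivZPowers hfin)
  have hcard : Fintype.card G = p := by
    rw [Fintype.card_eq_nat_card, Nat.card_zpowers, orderOf_eq_prime hσLp hσL1]
  haveI : FaithfulSMul G L := ⟨fun {g₁ g₂} h => Subtype.ext (RingEquiv.ext h)⟩
  let K : Subfield L := FixedPoints.subfield G L
  have memK : ∀ l : L, l ∈ K ↔ σL l = l := by
    intro l
    change (∀ g : G, g • l = l) ↔ _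
    constructor
    · intro h
      exact h ⟨σL, Subgroup.mem_zpowers σL⟩
    · intro h g
      change (g : L ≃+* L) • l = l
      exact smul_eq_self_of_mem_zpowers g.2 h
  have hfinrank : Module.finrank K L = p := by rw [FixedPoints.finrank_eq_card, hcard]
  -- `y` seen in `L`; its minimal polynomial over `K` has degree `p`
  let yL : L := ι y
  have hyK : yL ∉ (algebraMap K L).range := by
    rintro ⟨k, hk⟩
    apply hy
    have h1 : σL yL = yL := by rw [← hk]; exact (memK _).mp k.2
    rw [hσL] at h1
    exact sub_eq_zero.mpr (hι h1)
  have hint : IsIntegral K yL := FixedPoints.isIntegral G L yL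
  set d := (minpoly K yL).natDegree with hd_def
  have hd : d = p := by
    have hdvd : d ∣ p := hfinrank ▸ minpoly.degree_dvd hint
    rcases (Nat.dvd_prime hp).mp hdvd with h1 | h1
    · exact absurd (minpoly.natDegree_eq_one_iff.mp h1) hyK
    · exact h1
  -- the `K`-basis of `L` given by the powers of `yL`
  have hli : LinearIndependent K fun i : Fin d => yL ^ (i : ℕ) := linearIndependent_pow yL
  haveI : Nonempty (Fin d) := ⟨⟨0, by rw [hd]; exact hp.pos⟩⟩
  let bK : Module.Basis (Fin d) K L :=
    basisOfLinearIndependentOfCardEqFinrank hli (by rw [Fintype.card_fin, hfinrank, hd])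
  have hbK : ∀ i, bK i = yL ^ (i : ℕ) := fun i => by
    simp only [bK, coe_basisOfLinearIndependentOfCardEqFinrank]
  -- the `K`-linear divided-difference operators `Φ n`
  let gσ : G := ⟨σL, Subgroup.mem_zpowers σL⟩
  let τK : L →ₗ[K] L := (MulSemiringAction.toAlgHom K L gσ).toLinearMap
  have hτK : ∀ l, τK l = σL l := fun l => rfl
  let x : ℕ → L := fun k => ι ((σ ^ k) y - y)
  let Φ : ℕ → (L →ₗ[K] L) := fun n => Nat.rec (motive := fun _ => L →ₗ[K] L) LinearMap.id
      (fun n Φn => (LinearMap.mulLeft K (x (n + 1))⁻¹) ∘ₗ (τK - LinearMap.id) ∘ₗ Φn) n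
  have hΦ0 : ∀ l, Φ 0 l = l := fun l => rfl
  have hΦs : ∀ n l, Φ (n + 1) l = (x (n + 1))⁻¹ * ((σL : L →+* L) (Φ n l) - Φ n l) :=
    fun n l => rfl
  -- the table of complete homogeneous polynomial values and the node sequence `z k = σL^k yL`
  obtain ⟨H, hH0, hH1, hH2⟩ := kl_cH_exists (R := L)
  let z : ℕ → L := fun k => (σL ^ k) yL
  have hz0 : z 0 = yL := by simp [z]
  have hzs : ∀ k, z (k + 1) = (σL : L →+* L) (z k) := fun k => by
    simp only [z, RingEquiv.coe_toRingHom]; rw [kl_pow_succ_apply]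
  have hxz : ∀ k, x k = z k - z 0 := by
    intro k; simp only [x, z, map_sub, hσLpow, pow_zero, RingAut.one_apply, yL]
  -- `x k ≠ 0` for `1 ≤ k < p`
  have hx0 : ∀ k, 1 ≤ k → k < p → x k ≠ 0 := by
    intro k hk1 hkp hk0
    have h1 : (σ ^ k) y - y = 0 := hι (by rw [map_zero]; exact hk0)
    have h2 : (σ ^ k) y = y := sub_eq_zero.mp h1
    obtain ⟨m, hm⟩ := kl_exists_pow_pow_eq σ hp hσ hk1 hkp
    have h3 : ∀ t : ℕ, ((σ ^ k) ^ t) y = y := by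
      intro t
      induction t with
      | zero => simp
      | succ t iht => rw [kl_pow_succ_apply', h2, iht]
    apply hy
    have h4 : σ y = y := by conv_lhs => rw [← hm]; exact h3 m
    rw [h4, sub_self]
  have hgen : ∀ k, 1 ≤ k → k < p → ∀ b, σ b - b ∈ Ideal.span {(σ ^ k) y - y} := by
    intro k hk1 hkp b
    rw [← kl_span_eq_span_pow_sub σ hp hσ y hy hI hk1 hkp]
    exact Ideal.subset_span ⟨b, rfl⟩
  -- Lemma 4 and integrality, instantiated
  have F2 : ∀ n, n < p →
      (∀ e, Φ n (yL ^ (n + e)) = H z n e) ∧ (∀ i, i < n → Φ n (yL ^ i) = 0) := by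
    intro n hn
    have := kl_phi_pow (σL : L →+* L) z hzs x hxz (fun n l => Φ n l) hΦ0 hΦs H hH0 hH1 hH2 n
      (fun k hk1 hkn => hx0 k hk1 (lt_of_le_of_lt hkn hn))
    rwa [hz0] at this
  have F3 : ∀ n, n < p → ∀ b : B, ∃ c : B, Φ n (ι b) = ι c := fun n hn b =>
    kl_phi_integral σ (σL : L →+* L) hσL (fun k => (σ ^ k) y - y) x (fun k => rfl) hx0 hgen
      (fun n l => Φ n l) hΦ0 hΦs n hn b
  -- an element of `B` fixed by `σL` lies in `A`
  have hKA : ∀ c : B, σL (ι c) = ι c → c ∈ A := fun c hc =>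
    (memA c).mpr (hι (by rw [← hσL]; exact hc))
  -- spanning: `B = ∑_{i<d} A y^i`, by descending induction on the top nonzero coordinate
  let v : Fin d → B := fun i => y ^ (i : ℕ)
  let M : Submodule A B := Submodule.span A (Set.range v)
  have hT : ∀ n, ∀ b : B, (∀ i : Fin d, n ≤ (i : ℕ) → bK.repr (ι b) i = 0) → b ∈ M := by
    intro n
    induction n with
    | zero =>
      intro b hb
      have h1 : ι b = 0 := by
        rw [← bK.sum_repr (ι b)]
        exact Finset.sum_eq_zero fun i _ => by rw [hb i (Nat.zero_le _), zero_smul]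
      have hb0 : b = 0 := hι (by rw [h1, map_zero])
      rw [hb0]
      exact M.zero_mem
    | succ n ih =>
      intro b hb
      by_cases hn : n < d
      · let i₀ : Fin d := ⟨n, hn⟩
        have hnp : n < p := hd ▸ hn
        -- `Φ n (ι b)` is the `n`-th coordinate of `ι b`
        have hΦb : Φ n (ι b) = (bK.repr (ι b) i₀ : L) := by
          conv_lhs => rw [← bK.sum_repr (ι b)]
          rw [map_sum, Finset.sum_eq_single i₀]
          · rw [map_smul, hbK]
            have e1 := (F2 n hnp).1 0
            rw [add_zero, kl_cH_zero_right H hH0 hH1] at e1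
            change bK.repr (ι b) i₀ • Φ n (yL ^ n) = _
            rw [e1, Algebra.smul_def, mul_one]
            rfl
          · intro i _ hi
            have hne : (i : ℕ) ≠ n := fun h => hi (Fin.ext h)
            rcases lt_or_gt_of_ne hne with hlt | hgt
            · rw [map_smul, hbK, (F2 n hnp).2 i hlt, smul_zero]
            · rw [hb i hgt, zero_smul, map_zero]
          · intro h
            exact absurd (Finset.mem_univ i₀) h
        obtain ⟨c, hc⟩ := F3 n hnp b
        have hcK : σL (ι c) = ι c := by
          rw [← hc, hΦb]
          exact (memK _).mp (bK.repr (ι b) i₀).2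
        let a : A := ⟨c, hKA c hcK⟩
        have hιa : ι (a • y ^ n) = (bK.repr (ι b) i₀) • bK i₀ := by
          rw [Subring.smul_def, smul_eq_mul, map_mul, map_pow, hbK, Algebra.smul_def]
          change ι c * ι y ^ n = (bK.repr (ι b) i₀ : L) * yL ^ n
          rw [← hΦb, hc]
        have hb' : b - a • y ^ n ∈ M := by
          apply ih
          intro i hi
          rw [map_sub, hιa, map_sub, map_smul, bK.repr_self, Finsupp.sub_apply,
            Finsupp.smul_apply, Finsupp.single_apply]
          by_cases hii : i₀ = i
          · rw [if_pos hii, smul_eq_mul, mul_one, ← hii, sub_self]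
          · rw [if_neg hii, smul_zero, sub_zero]
            have hne : (i : ℕ) ≠ n := fun h => hii (Fin.ext h.symm)
            exact hb i (lt_of_le_of_ne hi hne.symm)
        have heq : b = (b - a • y ^ n) + a • y ^ n := (sub_add_cancel _ _).symm
        rw [heq]
        exact M.add_mem hb' (M.smul_mem a (Submodule.subset_span ⟨i₀, rfl⟩))
      · exact ih b fun i hi => absurd i.2 (not_lt.mpr (le_trans (not_lt.mp hn) hi))
  have hspan : ⊤ ≤ M := fun b _ => hT d b fun i hi => absurd i.2 (not_lt.mpr hi)
  -- linear independence over `A`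
  have hliA : LinearIndependent A v := by
    rw [Fintype.linearIndependent_iff]
    intro g hg i
    let g' : Fin d → K := fun i =>
      ⟨ι (g i), (memK _).mpr (by rw [hσL, (memA _).mp (g i).2])⟩
    have hsum : ∑ i, g' i • bK i = 0 := by
      have h1 := congrArg ι hg
      rw [map_sum, map_zero] at h1
      rw [← h1]
      refine Finset.sum_congr rfl fun i _ => ?_
      rw [hbK, Algebra.smul_def, Subring.smul_def, smul_eq_mul, map_mul, map_pow]
      rfl
    have h0 := Fintype.linearIndependent_iff.mp bK.linearIndependent g' hsum i
    have h2 : ι (g i) = 0 := congrArg Subtype.val h0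
    have h3 : (g i : B) = 0 := hι (by rw [h2, map_zero])
    exact Subtype.ext h3
  let bA : Module.Basis (Fin d) A B := Module.Basis.mk hliA hspan
  refine ⟨bA.reindex (finCongr hd), fun i => ?_⟩
  rw [Module.Basis.reindex_apply, Module.Basis.mk_apply]
  simp [v]


/-- **`B = B^σ + y·B`** for an augmentation generator `y` (consequence of Prop. 5): every `b ∈ B`
is `a + y c` with `σ a = a`. [cite: KiralyLutkebohmert2013, Prop. 5 and proof of Thm. 2 (a)⇒(e), p. 69] -/
theorem kl_exists_fixed_add_mul {B : Type*} [CommRing B] [IsDomain B] [IsLocalRing B] {p : ℕ}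
    (hp : p.Prime) (σ : B ≃+* B) (hσ : σ ^ p = 1) (y : B) (hy : σ y - y ≠ 0)
    (hI : Ideal.span (Set.range fun c : B => σ c - c) = Ideal.span {σ y - y}) (b : B) :
    ∃ a : B, σ a = a ∧ ∃ c : B, b = a + y * c := by
  obtain ⟨bs, hbs⟩ := kl_exists_basis_pow hp σ hσ y hy hI
  -- the `B^σ`-submodule `B^σ + y B`
  let N : Submodule ((σ : B →+* B).eqLocus (RingHom.id B)) B :=
    { carrier := {b | ∃ a : B, σ a = a ∧ ∃ c : B, b = a + y * c}
      zero_mem' := ⟨0, by simp, 0, by simp⟩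
      add_mem' := by
        rintro _ _ ⟨a₁, ha₁, c₁, rfl⟩ ⟨a₂, ha₂, c₂, rfl⟩
        exact ⟨a₁ + a₂, by rw [map_add, ha₁, ha₂], c₁ + c₂, by ring⟩
      smul_mem' := by
        rintro r _ ⟨a, ha, c, rfl⟩
        refine ⟨(r : B) * a, ?_, (r : B) * c, ?_⟩
        · have hr : σ (r : B) = r := r.2
          rw [map_mul, hr, ha]
        · rw [Subring.smul_def, smul_eq_mul]; ring }
  have hN : ∀ i : Fin p, (bs i : B) ∈ N := by
    intro i
    rw [hbs i]
    rcases Nat.eq_zero_or_pos (i : ℕ) with h0 | hpos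
    · exact ⟨1, by simp, 0, by simp [h0]⟩
    · refine ⟨0, by simp, y ^ ((i : ℕ) - 1), ?_⟩
      rw [zero_add, ← pow_succ', Nat.sub_add_cancel hpos]
  have htop : (⊤ : Submodule ((σ : B →+* B).eqLocus (RingHom.id B)) B) ≤ N := by
    rw [← bs.span_eq, Submodule.span_le]
    rintro _ ⟨i, rfl⟩
    exact hN i
  obtain ⟨a, ha, c, hc⟩ := htop (Submodule.mem_top (x := b))
  exact ⟨a, ha, c, hc⟩

end Basis

section Pseudoreflection

/-- **Király–Lütkebohmert, Theorem 2, (a) ⇒ (e)** (residue-trivial case): let `B` be a local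
Noetherian domain with a ring automorphism `σ`, `σ^p = 1` for a prime `p`, such that every element
of `B` is congruent modulo `𝔪_B` to a `σ`-invariant one (`k_{B^σ} = k_B`). If the augmentation
ideal `(σ c − c : c ∈ B)` is principal, then for every finite generating family `x₀, …, xₙ` of
`𝔪_B` there are an index `i` with `(σ c − c : c) = (σ xᵢ − xᵢ)` and a generating family `x'` of
`𝔪_B` with `x'ᵢ = xᵢ` and `σ x'ⱼ = x'ⱼ` for all `j ≠ i`: the action is a pseudoreflection
(Def. 1). Proof as printed: Prop. 6 (ii) picks `i`; by Prop. 5, `xⱼ = a₀ⱼ + xᵢ·(…)` with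
`a₀ⱼ ∈ B^σ ∩ 𝔪_B`, and `x'ⱼ := a₀ⱼ`. [cite: KiralyLutkebohmert2013, Thm. 2 (a)⇒(e), p. 69] -/
theorem kl_pseudoreflection_of_isPrincipal {B : Type*} [CommRing B] [IsDomain B] [IsLocalRing B]
    [IsNoetherianRing B] {p : ℕ} (hp : p.Prime) (σ : B ≃+* B) (hσ : σ ^ p = 1)
    (hres : ∀ b : B, ∃ a : B, σ a = a ∧ b - a ∈ maximalIdeal B)
    (hP : (Ideal.span (Set.range fun c : B => σ c - c)).IsPrincipal)
    {n : ℕ} (x : Fin (n + 1) → B) (hx : Ideal.span (Set.range x) = maximalIdeal B) :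
    ∃ (i : Fin (n + 1)) (x' : Fin (n + 1) → B), x' i = x i ∧ (∀ j, j ≠ i → σ (x' j) = x' j) ∧
      Ideal.span (Set.range x') = maximalIdeal B ∧
      Ideal.span (Set.range fun c : B => σ c - c) = Ideal.span {σ (x i) - x i} := by
  classical
  obtain ⟨i, hi⟩ := kl_exists_index_augIdeal_eq_span_singleton σ hres x hx hP
  have hxm : ∀ j, x j ∈ maximalIdeal B := fun j => hx ▸ Ideal.subset_span ⟨j, rfl⟩
  by_cases hy : σ (x i) - x i = 0
  · -- degenerate case: the augmentation ideal vanishes, `σ = id`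
    refine ⟨i, x, rfl, fun j _ => ?_, hx, hi⟩
    have h := (hi ▸ Ideal.subset_span ⟨x j, rfl⟩ :
      σ (x j) - x j ∈ Ideal.span {σ (x i) - x i})
    rw [hy, Ideal.span_singleton_eq_bot.mpr rfl, Ideal.mem_bot] at h
    exact sub_eq_zero.mp h
  · choose a ha c hc using fun j => kl_exists_fixed_add_mul hp σ hσ (x i) hy hi (x j)
    let x' : Fin (n + 1) → B := fun j => if j = i then x i else a j
    have hx'i : x' i = x i := by simp [x']
    have hx'j : ∀ j, j ≠ i → x' j = a j := fun j hj => by simp [x', hj]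
    refine ⟨i, x', hx'i, fun j hj => by rw [hx'j j hj, ha j], ?_, hi⟩
    apply le_antisymm
    · rw [Ideal.span_le]
      rintro _ ⟨j, rfl⟩
      by_cases hj : j = i
      · subst hj
        rw [SetLike.mem_coe, hx'i]
        exact hxm _
      · rw [SetLike.mem_coe, hx'j j hj]
        have e : a j = x j - x i * c j := by rw [hc j]; ring
        rw [e]
        exact sub_mem (hxm j) (Ideal.mul_mem_right _ _ (hxm i))
    · rw [← hx, Ideal.span_le]
      rintro _ ⟨j, rfl⟩
      have hi' : x i ∈ Ideal.span (Set.range x') := hx'i ▸ Ideal.subset_span ⟨i, rfl⟩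
      by_cases hj : j = i
      · subst hj; exact hi'
      · have hj' : a j ∈ Ideal.span (Set.range x') := hx'j j hj ▸ Ideal.subset_span ⟨j, rfl⟩
        rw [SetLike.mem_coe, hc j]
        exact add_mem hj' (Ideal.mul_mem_right _ _ hi')

end Pseudoreflection

section Monogenous

/-! ## Thm. 2 (a) ⇔ (b): principal augmentation ideal ⇔ monogenous over the fixed ring (appended) -/

/-- **Király–Lütkebohmert, Theorem 2, (a) ⇒ (b)**: with an augmentation generator `y` as in
Prop. 5 (`B` a local domain, `σ^p = 1`, `p` prime, `(σ c − c : c) = (σ y − y) ≠ 0`), `B` is a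
MONOGENOUS algebra over the fixed ring: `B = B^σ[y]`. [cite: KiralyLutkebohmert2013, Thm. 2 (a)⇒(b), p. 68] -/
theorem kl_adjoin_eq_top {B : Type*} [CommRing B] [IsDomain B] [IsLocalRing B] {p : ℕ}
    (hp : p.Prime) (σ : B ≃+* B) (hσ : σ ^ p = 1) (y : B) (hy : σ y - y ≠ 0)
    (hI : Ideal.span (Set.range fun c : B => σ c - c) = Ideal.span {σ y - y}) :
    Algebra.adjoin ((σ : B →+* B).eqLocus (RingHom.id B)) {y} = ⊤ := by
  obtain ⟨bs, hbs⟩ := kl_exists_basis_pow hp σ hσ y hy hI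
  rw [eq_top_iff]
  intro b _
  rw [← bs.sum_repr b]
  refine Subalgebra.sum_mem _ fun i _ => Subalgebra.smul_mem _ ?_ _
  rw [hbs i]
  exact Subalgebra.pow_mem _ (Algebra.subset_adjoin (Set.mem_singleton y)) _

/-- **Király–Lütkebohmert, Theorem 2, (b) ⇒ (a)** (any commutative ring): if `B = B^σ[y]` is
monogenous over the fixed ring of a ring automorphism `σ`, then the augmentation ideal
`(σ c − c : c ∈ B)` is principal, generated by `σ y − y` (Remark 3 (i): `I(bc) = I(b)σ(c) + bI(c)`).
[cite: KiralyLutkebohmert2013, Thm. 2 (b)⇒(a), p. 68] -/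
theorem kl_augIdeal_eq_span_singleton_of_adjoin_eq_top {B : Type*} [CommRing B] (σ : B ≃+* B)
    (y : B) (h : Algebra.adjoin ((σ : B →+* B).eqLocus (RingHom.id B)) {y} = ⊤) :
    Ideal.span (Set.range fun c : B => σ c - c) = Ideal.span {σ y - y} := by
  apply le_antisymm
  · rw [Ideal.span_le]
    rintro _ ⟨c, rfl⟩
    have hc : c ∈ Algebra.adjoin ((σ : B →+* B).eqLocus (RingHom.id B)) {y} := h ▸ Algebra.mem_top
    show σ c - c ∈ Ideal.span {σ y - y}
    induction hc using Algebra.adjoin_induction with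
    | mem x hx =>
      rw [Set.mem_singleton_iff.mp hx]
      exact Ideal.mem_span_singleton_self _
    | algebraMap r =>
      have hr : σ (r : B) = r := r.2
      change σ (r : B) - r ∈ _
      rw [hr, sub_self]
      exact zero_mem _
    | add x z _ _ ihx ihz =>
      have e : σ (x + z) - (x + z) = (σ x - x) + (σ z - z) := by rw [map_add]; ring
      rw [e]
      exact add_mem ihx ihz
    | mul x z _ _ ihx ihz =>
      rw [kl_aug_mul]
      exact add_mem (Ideal.mul_mem_right _ _ ihx) (Ideal.mul_mem_left _ _ ihz)
  · rw [Ideal.span_le, Set.singleton_subset_iff]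
    exact Ideal.subset_span ⟨y, rfl⟩

end Monogenous

end Summit.ResolutionOfSingularities.ResolutionOfSingularities.Theorems
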